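import Summits.QuantumFields.BalabanUV.Beta.GAN24.GaugeReadSourcePairing
import Summits.QuantumFields.BalabanUV.Beta.GAN24.SrecExitChargeLevelZero

/-!
# `BalabanUV.Beta.GAN24.GaugeReadExitPairing` — binder row G-an2-4 ∕ (CONV-C), the (S) row of RULING R-gan24p1-g27-1 B (viii), the Ward-type half (W-γ), EXIT class, jb = 0:
# **THE (γ) EXIT PAIRING IN CLOSED FORM — `⟨(d*d)m, (G₀∘𝒟(e))^{F} dzψ⟩ = −(cE∕2)·Σ_ℓ ψ(t_ℓ+e_{l_ℓ})·colH G₀(e)_ℓ·((d*d)m)_ℓ + (cE∕4 − cΛ·wM1_0·(2Lc^{d+1})⁻¹)·⟨𝒬_{Lc}(σ_ψ⊙n_m), colM G₀(e)⟩`,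
# EVERY bounded `Lc`-periodic `m`, EVERY bounded `ψ`** — ENGINE E-leaf06-g46-1 (M1) modulo the displayed defect whose vanishing is (M3)
# (G-an2-4 formalisation swarm → CRUX TEAM (2), seat `b2b-balaban-gan24-formalise-leaf-06` = the (γ) hand, gen 47, INTENT 1 FILE C)

NOT IN PRINT; OUR BOOKKEEPING ([folklore] BY NAME over FILE B `GaugeReadSourcePairing.gaugeLeg_sourcePairing_dM`, g46 `ExitPairingSourceForm.exitPairing_eq_source'` and `EdgePotentialColumnOrthogonal`
(`abs_axProjAt_le`, `contourSum_axProjAt`, `contourSum_add_coarse`), an2's `axProjAt_eq_zero_of_isCombBond` ∕ `vertexFamily_dM` ∕ `biLoc_comp_decays`, leaf-02's `blk_add_unitVec_of_exitFace` ∕ `dz_blk_eq_ite`,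
an1's `KernelWardResponse.decays_of_biLoc`; 0 `def`, 0 cited fact, 0 `def … : Prop`, 0 sorry).  HONEST FRAMING (cell contract, verbatim): «discharging `BetaPertH` makes Bałaban's UV stability
UNCONDITIONAL — a real constructive-QFT result; it is NOT the continuum limit and NOT the Clay problem.»  HONEST DEPENDENCY (verbatim): «continuum YM on T⁴ ⇐ BetaPertH ∧ nine spine estimates
(0/9 proved); BetaPertH ⇐ (D1) ∧ (D4) ∧ CAP+tail; G-an2-4 gates asym, D1 and NE2/3/4.»
* §1 THE SOURCE FORM `n_m := Π^ρ m − (Lc^{d+1})⁻¹·(𝒬_{Lc}m)(·,0)⊙𝟙^{exit}` (written out, no `def`): `not_isCombBondAt_of_exit` (an exit bond is never a comb bond), `sourceForm_eq_zero_of_isCombBond`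
  (COMB-FREE), `abs_sourceForm_le` (BOUNDED), `contourSum_exitForm` (every straight block contour crosses the exit face once: `𝒬(q⊙𝟙^{exit}) = q·#box`),
  **`contourSum_sourceForm_eq_zero`** (`𝒬_{Lc} n_m ≡ 0` for periodic `m`), **`curvAdj_curv_sourceForm`** (`d*d n_m = d*d m`).
* §2 `summable_mul_col_of_biLoc` ∕ `summable_row_mul_of_biLoc`.
* §3 **`maxwellRead_comp_eq_sourceRead`** (`W` spread and bi-localised): `Σ'_u Σ_κ (d*d m) κ u·(Σ'_x Σ_κ₂ (G₀∘W) u x (inl κ)(inl κ₂)·dzψ κ₂ x) = Σ'_x Σ_κ₂ dzψ κ₂ x·(Σ'_u Σ_κ n_m κ u·W u x (inl κ)(inl κ₂))`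
  (Fubini + g46's source form per column).
* §4 **`gaugeRead_exitPairing`** (the headline, `W = 𝒟(e)`) and **`gaugeRead_exitPairing_gaugeWt`** (`ψ = 1_{B(y)}`, `dzψ = gaugeWt Lc y` — road-P2's `CombSlotDerivativeBorderRead.gaugeWt_eq_dz`): the `(d*d)m`-read of the (γ) read
  weights of `GaugeReadChargeComb` at the slot `(ν, y′)` and label `y`.
READING.  With `m = m̃_ab` (g46 `EdgePlaquettePotential`; `d*d m̃_ab = ½·d*d m_ab` of leaf-02 g56's `SrecExitChargeLevelZero`, which makes this read `−(4∕cE)×` the exit⊗exit (γ) charge of the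
slot) the first term is ENGINE (M1)'s `R(e) = Σ_ℓ ((d*d)m̃)_ℓ·g⁺(ℓ)·colH(e)_ℓ` (`g⁺ = ½·1_{B(y)}(·+e)`), exact at D = 2, Bc = 3, jb = 0; the second term is ENGINE (M3)'s «sE − R + s2 + sM», a
multiple of the block contour sums `𝒬_{Lc}(σ_{1_B}⊙n_{m̃})`, which VANISH for the edge potential (exact arithmetic, every root; to be typed as the explicit comb-free representative — then (M1)
is a theorem and, with g46 (M2) `edgePotential_orthogonal_colH` and leaf-02's level-0 charge table, `C_ab(e) = 0` at jb = 0).  Asserts NO value of any resolvent column; the defect is DISPLAYED,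
not discharged; NOTHING of (W-γ) ∕ (INV) ∕ (S) ∕ (Q-R) ∕ «T2Shape» ∕ (hW, hWall) discharged; NEVER «G-an2-4 closed» as (CONV-C); NOT D1, NOT `BetaPertH`, NOT continuum, NOT Clay.
2026-08-22; no existing file touched.
-/

noncomputable section

open Finset
open scoped BigOperators
open Literature.MathematicalPhysics.QuantumFieldTheory
open Literature.MathematicalPhysics.QuantumFieldTheory.Balaban1983to89
open Literature.MathematicalPhysics.QuantumFieldTheory.Balaban1983to89.Beta
open B12Sec2to5 (l1 l1_nonneg)
open ExpKernelCalculus (Site MKer Decays BiLoc VertexFamily Zl comp summable_exp_shift' biLoc_comp_decays)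
open AffineAveraging (Form0 Form1 Form2 box toSite unitVec unitVec_apply dz curv curvAdj contourSum)
open AveragingContours (blk)
open RootedComb (axProjAt)
open OneStepResolventKernel (Fib LocStencil decays_mono biLoc_mono)
open OneStepKernelFamily (KInvStep colH)
open SecondOrderResponse (colM dM vertexFamily_dM)
open BalabanStepW2 (wM1)
open BalabanStepJets (locStencil_mono)
open Summit.QuantumFields.BalabanUV.Beta.TameKernelCalculus
open Summit.QuantumFields.BalabanUV.Beta.AxialDressingRooted (IsCombBondAt coDressKBmAt spr_coDressKBmAt decays_coDressKBmAt_KInvStep one_le_of_neZero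
  axProjAt_eq_zero_of_isCombBond)
open Summit.QuantumFields.BalabanUV.Beta.SpineRooted (SpureRecAt M1At locStencil_SpureRecAt vertexFamily_M1At)
open Summit.QuantumFields.BalabanUV.Beta.KernelWardRelative (gaugeWt)
open Summit.QuantumFields.BalabanUV.Beta.KernelWardResponse (decays_of_biLoc)
open Summit.QuantumFields.BalabanUV.Beta.GAN24.KernelLegCharges (summable_prod_of_biLoc)
open Summit.QuantumFields.BalabanUV.Beta.GAN24.GaugeReadChargeProfile (biLoc_weightMul)
open Summit.QuantumFields.BalabanUV.Beta.GAN24.EdgePotentialColumnOrthogonal (abs_axProjAt_le axProjAt_eq_sub_dz contourSum_axProjAt contourSum_add_coarse contourSum_sub_apply)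
open Summit.QuantumFields.BalabanUV.Beta.GAN24.EdgePlaquettePotential (curvAdj_curv_sub_dz)
open Summit.QuantumFields.BalabanUV.Beta.GAN24.ExitPairingSourceForm (exitPairing_eq_source')
open Summit.QuantumFields.BalabanUV.Beta.GAN24.FaceChargeCurlResummation (dz_blk_eq_ite)
open Summit.QuantumFields.BalabanUV.Beta.GAN24.SrecExitChargeLevelZero (blk_add_unitVec_of_exitFace)
open Summit.QuantumFields.BalabanUV.Beta.GAN24.CombFreeGaugeLegCharges (abs_curvAdj_curv_le)
open KKTFluctuationEnergy (abs_dz_le)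
open Summit.QuantumFields.BalabanUV.Beta.GAN24.CombSlotDerivativeBorderRead (gaugeWt_eq_dz)
open AveragingWardStencils (b6UnitVec_eq)
open Summit.QuantumFields.BalabanUV.Beta.GAN24.GaugeReadSourcePairing (gaugeLeg_sourcePairing_dM)

namespace Summit.QuantumFields.BalabanUV.Beta.GAN24.GaugeReadExitPairing

variable {d : ℕ}

/-! ## §1 The field part of the response to the Maxwell source: `n_m := Π^ρ m − (Lc^{d+1})⁻¹·(𝒬_{Lc} m)⊙𝟙^{exit}` -/

/-- [folklore] **AN EXIT BOND IS NOT A COMB BOND** (`1 ≤ L`): a bond `(κ, u)` with `u_κ % L = L − 1` crosses into the next block (leaf-02's `blk_add_unitVec_of_exitFace`),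
so it violates the second clause of `IsCombBondAt`. -/
theorem not_isCombBondAt_of_exit {L : ℕ} (hL : 1 ≤ L) (ρ : Fin (d + 1) → ℤ) {κ : Fin (d + 1)} {u : Site (d + 1)} (hu : u κ % (L : ℤ) = (L : ℤ) - 1) :
    ¬ IsCombBondAt ρ L κ u := by
  rintro ⟨-, hblk⟩
  rw [blk_add_unitVec_of_exitFace hL hu] at hblk
  have h := congrArg (fun f => f κ) hblk
  simp only [Pi.add_apply, unitVec_apply, if_true] at h
  linarith

/-- [folklore] The exit-weighted constant form vanishes on the comb bonds. -/
theorem exitForm_eq_zero_of_isCombBond {L : ℕ} (hL : 1 ≤ L) {ρ : Fin (d + 1) → ℤ} (q : Fin (d + 1) → ℝ) {κ : Fin (d + 1)} {u : Site (d + 1)}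
    (h : IsCombBondAt ρ L κ u) : q κ * (if u κ % (L : ℤ) = (L : ℤ) - 1 then (1 : ℝ) else 0) = 0 := by
  by_cases hu : u κ % (L : ℤ) = (L : ℤ) - 1
  · exact (not_isCombBondAt_of_exit hL ρ hu h).elim
  · rw [if_neg hu, mul_zero]

/-- [folklore] **`n_m` VANISHES ON THE COMB BONDS** (`Π^ρ m` does — an2's `axProjAt_eq_zero_of_isCombBond`; the exit form does — above). -/
theorem sourceForm_eq_zero_of_isCombBond {Lc : ℕ} (hLc : 1 ≤ Lc) (ρ : Fin (d + 1) → ℤ) (m : Form1 (d + 1) ℝ) (c : ℝ) (q : Fin (d + 1) → ℝ)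
    {κ : Fin (d + 1)} {u : Site (d + 1)} (h : IsCombBondAt ρ Lc κ u) :
    axProjAt ρ Lc m κ u - c * (q κ * (if u κ % (Lc : ℤ) = (Lc : ℤ) - 1 then (1 : ℝ) else 0)) = 0 := by
  rw [axProjAt_eq_zero_of_isCombBond h m, exitForm_eq_zero_of_isCombBond hLc q h, mul_zero, sub_zero]

/-- [folklore] **`n_m` IS BOUNDED** (`|Π^ρ m| ≤ B + 2(d+1)·Lc·B`, plus the exit form). -/
theorem abs_sourceForm_le {Lc : ℕ} (hLc : 1 ≤ Lc) {r : Fin (d + 1) → ℕ} (hr : r ∈ box (d + 1) Lc) {m : Form1 (d + 1) ℝ} {B : ℝ}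
    (hmB : ∀ κ u, |m κ u| ≤ B) (c : ℝ) (q : Fin (d + 1) → ℝ) (κ : Fin (d + 1)) (u : Site (d + 1)) :
    |axProjAt (toSite r) Lc m κ u - c * (q κ * (if u κ % (Lc : ℤ) = (Lc : ℤ) - 1 then (1 : ℝ) else 0))|
      ≤ B + 2 * ((((d + 1 : ℕ) : ℝ)) * Lc * B) + |c| * ∑ l, |q l| := by
  have h1 := abs_axProjAt_le hLc hr hmB κ u
  have h2 : |c * (q κ * (if u κ % (Lc : ℤ) = (Lc : ℤ) - 1 then (1 : ℝ) else 0))| ≤ |c| * ∑ l, |q l| := by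
    rw [abs_mul]
    refine mul_le_mul_of_nonneg_left ?_ (abs_nonneg c)
    have h3 : |q κ * (if u κ % (Lc : ℤ) = (Lc : ℤ) - 1 then (1 : ℝ) else 0)| ≤ |q κ| := by
      rw [abs_mul]; split_ifs <;> simp
    exact h3.trans (Finset.single_le_sum (fun l _ => abs_nonneg (q l)) (Finset.mem_univ κ))
  exact (abs_sub _ _).trans (by linarith)

/-- [folklore] **THE STRAIGHT BLOCK CONTOUR SUM OF THE EXIT INDICATOR IS `#box = Lc^{d+1}`** (every straight contour of `Lc` bonds starting in a block crosses the block's exit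
face exactly once): `𝒬_{Lc}(q⊙𝟙^{exit}) κ w = q κ·#(box (d+1) Lc)`. -/
theorem contourSum_exitForm {Lc : ℕ} (hLc : 1 ≤ Lc) (q : Fin (d + 1) → ℝ) (κ : Fin (d + 1)) (w : Site (d + 1)) :
    contourSum Lc (fun κ' u => q κ' * (if u κ' % (Lc : ℤ) = (Lc : ℤ) - 1 then (1 : ℝ) else 0)) κ w = q κ * ((box (d + 1) Lc).card : ℝ) := by
  classical
  simp only [AffineAveraging.contourSum]
  have hL0 : (0 : ℤ) < Lc := by exact_mod_cast hLc
  have key : ∀ b ∈ box (d + 1) Lc, (∑ s ∈ Finset.range Lc, q κ * (if ((Lc : ℤ) • w + toSite b + (s : ℤ) • unitVec κ) κ % (Lc : ℤ) = (Lc : ℤ) - 1 then (1 : ℝ) else 0))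
      = q κ := by
    intro b hb
    have hbκ : b κ < Lc := Finset.mem_range.1 (Fintype.mem_piFinset.1 hb κ)
    have e : ∀ s ∈ Finset.range Lc, (q κ * (if ((Lc : ℤ) • w + toSite b + (s : ℤ) • unitVec κ) κ % (Lc : ℤ) = (Lc : ℤ) - 1 then (1 : ℝ) else 0))
        = if s = Lc - 1 - b κ then q κ else 0 := by
      intro s hs
      have hsL : s < Lc := Finset.mem_range.1 hs
      have ecoord : ((Lc : ℤ) • w + toSite b + (s : ℤ) • unitVec κ) κ = (Lc : ℤ) * w κ + ((b κ : ℕ) + s : ℕ) := by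
        simp only [Pi.add_apply, Pi.smul_apply, smul_eq_mul, AffineAveraging.toSite, unitVec_apply, if_true, mul_one]
        push_cast; ring
      rw [ecoord, add_comm ((Lc : ℤ) * w κ), Int.add_mul_emod_self_left]
      by_cases hbs : s = Lc - 1 - b κ
      · subst hbs
        have e2 : ((b κ + (Lc - 1 - b κ) : ℕ) : ℤ) = (Lc : ℤ) - 1 := by
          rw [show b κ + (Lc - 1 - b κ) = Lc - 1 by omega]; push_cast [hLc]; ring
        rw [e2, Int.emod_eq_of_lt (by linarith) (by linarith), if_pos rfl, if_pos rfl, mul_one]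
      · rw [if_neg hbs]
        have hne : ((b κ + s : ℕ) : ℤ) % (Lc : ℤ) ≠ (Lc : ℤ) - 1 := by
          by_cases hlt : b κ + s < Lc
          · rw [Int.emod_eq_of_lt (by positivity) (by exact_mod_cast hlt)]
            have : (b κ + s : ℕ) ≠ Lc - 1 := by omega
            intro h; apply this; exact_mod_cast (by rw [h]; push_cast [hLc]; ring : ((b κ + s : ℕ) : ℤ) = ((Lc - 1 : ℕ) : ℤ))
          · have hge : Lc ≤ b κ + s := not_lt.1 hlt
            have e3 : ((b κ + s : ℕ) : ℤ) = ((b κ + s - Lc : ℕ) : ℤ) + 1 * (Lc : ℤ) := by push_cast [hge]; ring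
            rw [e3, Int.add_mul_emod_self_right, Int.emod_eq_of_lt (by positivity) (by exact_mod_cast (by omega : b κ + s - Lc < Lc))]
            have : (b κ + s - Lc : ℕ) ≠ Lc - 1 := by omega
            intro h; apply this; exact_mod_cast (by rw [h]; push_cast [hLc]; ring : ((b κ + s - Lc : ℕ) : ℤ) = ((Lc - 1 : ℕ) : ℤ))
        rw [if_neg hne, mul_zero]
    rw [Finset.sum_congr rfl e, Finset.sum_ite_eq' (Finset.range Lc) (Lc - 1 - b κ) (fun _ => q κ), if_pos (Finset.mem_range.2 (by omega))]
  rw [Finset.sum_congr rfl key, Finset.sum_const, nsmul_eq_mul, mul_comm]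

/-- NOT IN PRINT; OUR BOOKKEEPING.  **THE BLOCK CONTOUR SUMS OF `n_m` VANISH** (`m` bounded `Lc`-periodic, in-block root): `𝒬_{Lc}(Π^ρ m) = 𝒬_{Lc} m = const` per direction
(g46 INTENT 3), and the exit form carries exactly that constant (`contourSum_exitForm`, `#box = Lc^{d+1}`). -/
theorem contourSum_sourceForm_eq_zero {Lc : ℕ} [NeZero Lc] (r : Fin (d + 1) → ℕ) {m : Form1 (d + 1) ℝ}
    (hper : ∀ κ x v, m κ (x + (Lc : ℤ) • v) = m κ x) (κ : Fin (d + 1)) (w : Site (d + 1)) :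
    contourSum Lc (fun κ' u => axProjAt (toSite r) Lc m κ' u
        - ((Lc : ℝ) ^ (d + 1))⁻¹ * (contourSum Lc m κ' 0 * (if u κ' % (Lc : ℤ) = (Lc : ℤ) - 1 then (1 : ℝ) else 0))) κ w = 0 := by
  have hLc : 1 ≤ Lc := one_le_of_neZero Lc
  have hL : ((Lc : ℝ) ^ (d + 1)) ≠ 0 := pow_ne_zero _ (by exact_mod_cast NeZero.ne Lc)
  rw [contourSum_sub_apply, contourSum_axProjAt hLc (toSite r) hper]
  have h1 : contourSum Lc m κ w = contourSum Lc m κ 0 := by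
    have := contourSum_add_coarse hper κ 0 w; rwa [zero_add] at this
  have h2 : contourSum Lc (fun κ' u => ((Lc : ℝ) ^ (d + 1))⁻¹ * (contourSum Lc m κ' 0 * (if u κ' % (Lc : ℤ) = (Lc : ℤ) - 1 then (1 : ℝ) else 0))) κ w
      = ((Lc : ℝ) ^ (d + 1))⁻¹ * (contourSum Lc m κ 0 * ((box (d + 1) Lc).card : ℝ)) := by
    rw [← contourSum_exitForm hLc (fun κ' => contourSum Lc m κ' 0) κ w]
    simp only [AffineAveraging.contourSum, Finset.mul_sum]
  rw [h1, h2, show (box (d + 1) Lc).card = Lc ^ (d + 1) by simp [AffineAveraging.box, Fintype.card_piFinset]]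
  push_cast
  field_simp
  ring

/-- NOT IN PRINT; OUR BOOKKEEPING.  **`n_m` HAS THE MAXWELL IMAGE OF `m`**: `d*d n_m = d*d m` (the hard-axial change is exact; the exit form is the gradient of `Σ_κ q_κ·⌊·_κ∕Lc⌋`). -/
theorem curvAdj_curv_sourceForm {Lc : ℕ} (hLc : 1 ≤ Lc) (ρ : Fin (d + 1) → ℤ) (m : Form1 (d + 1) ℝ) (c : ℝ) (q : Fin (d + 1) → ℝ) :
    curvAdj (curv (fun κ' u => axProjAt ρ Lc m κ' u - c * (q κ' * (if u κ' % (Lc : ℤ) = (Lc : ℤ) - 1 then (1 : ℝ) else 0))))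
      = curvAdj (curv m) := by
  have e : (fun κ' u => axProjAt ρ Lc m κ' u - c * (q κ' * (if u κ' % (Lc : ℤ) = (Lc : ℤ) - 1 then (1 : ℝ) else 0)))
      = fun κ' u => m κ' u - dz (fun w => AveragingContoursRooted.treeGaugeAt ρ m Lc w + c * ∑ l, q l * (((w l / (Lc : ℤ) : ℤ)) : ℝ)) κ' u := by
    funext κ' u
    rw [axProjAt_eq_sub_dz]
    have hd : dz (fun w => AveragingContoursRooted.treeGaugeAt ρ m Lc w + c * ∑ l, q l * (((w l / (Lc : ℤ) : ℤ)) : ℝ)) κ' u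
        = dz (AveragingContoursRooted.treeGaugeAt ρ m Lc) κ' u + c * ∑ l, q l * dz (fun w : Site (d + 1) => (((w l / (Lc : ℤ) : ℤ)) : ℝ)) κ' u := by
      simp only [AffineAveraging.dz, Finset.mul_sum]
      have e4 : ∑ i, c * (q i * ((((u + unitVec κ') i / (Lc : ℤ) : ℤ)) : ℝ)) - ∑ i, c * (q i * (((u i / (Lc : ℤ) : ℤ)) : ℝ))
          = ∑ i, c * (q i * (((((u + unitVec κ') i / (Lc : ℤ) : ℤ)) : ℝ) - (((u i / (Lc : ℤ) : ℤ)) : ℝ))) := by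
        rw [← Finset.sum_sub_distrib]; exact Finset.sum_congr rfl fun i _ => by ring
      rw [← e4]; ring
    rw [hd]
    have hs : ∑ l, q l * dz (fun w : Site (d + 1) => (((w l / (Lc : ℤ) : ℤ)) : ℝ)) κ' u = q κ' * (if u κ' % (Lc : ℤ) = (Lc : ℤ) - 1 then (1 : ℝ) else 0) := by
      simp only [dz_blk_eq_ite hLc]
      rw [Finset.sum_eq_single κ' (fun l _ hl => by rw [if_neg (Ne.symm hl), mul_zero]) (fun h => (h (Finset.mem_univ _)).elim), if_pos rfl]
    rw [hs]
    ring
  rw [e, curvAdj_curv_sub_dz]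

/-! ## §2 Columns and rows of a bi-localised kernel against bounded weights -/

/-- [folklore] A bounded weight against a column (first leg) of a bi-localised kernel is summable. -/
theorem summable_mul_col_of_biLoc {W : MKer (d + 1) (Fib d)} {p q : Site (d + 1)} {C δ : ℝ} (hW : BiLoc W p q C δ) (hδ : 0 < δ)
    {f : Site (d + 1) → ℝ} {B : ℝ} (hf : ∀ u, |f u| ≤ B) (x : Site (d + 1)) (a b : Fib d) : Summable fun u => f u * W u x a b := by
  have hC : 0 ≤ C := hW.nonneg a
  refine Summable.of_norm_bounded (((summable_exp_shift' hδ p).mul_left (B * C)).mul_right (Real.exp (-δ * l1 (x - q)))) (fun u => ?_)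
  rw [Real.norm_eq_abs, abs_mul]
  have h := hW u x a b
  rw [mul_add, Real.exp_add] at h
  calc |f u| * |W u x a b| ≤ B * (C * (Real.exp (-δ * l1 (u - p)) * Real.exp (-δ * l1 (x - q)))) :=
        mul_le_mul (hf u) h (abs_nonneg _) ((abs_nonneg _).trans (hf u))
    _ = B * C * Real.exp (-δ * l1 (u - p)) * Real.exp (-δ * l1 (x - q)) := by ring

/-- [folklore] A row (second leg) of a bi-localised kernel against a bounded weight is summable. -/
theorem summable_row_mul_of_biLoc {W : MKer (d + 1) (Fib d)} {p q : Site (d + 1)} {C δ : ℝ} (hW : BiLoc W p q C δ) (hδ : 0 < δ)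
    {g : Site (d + 1) → ℝ} {B : ℝ} (hg : ∀ x, |g x| ≤ B) (u : Site (d + 1)) (a b : Fib d) : Summable fun x => W u x a b * g x := by
  have hC : 0 ≤ C := hW.nonneg a
  refine Summable.of_norm_bounded (((summable_exp_shift' hδ q).mul_left (C * Real.exp (-δ * l1 (u - p)))).mul_right B) (fun x => ?_)
  rw [Real.norm_eq_abs, abs_mul]
  have h := hW u x a b
  rw [mul_add, Real.exp_add] at h
  calc |W u x a b| * |g x| ≤ (C * (Real.exp (-δ * l1 (u - p)) * Real.exp (-δ * l1 (x - q)))) * B :=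
        mul_le_mul h (hg x) (abs_nonneg _) (mul_nonneg hC (by positivity))
    _ = C * Real.exp (-δ * l1 (u - p)) * Real.exp (-δ * l1 (x - q)) * B := by ring

/-! ## §3 From the Maxwell-image read of `G₀ ∘ W` to the source read of `W` against `n_m` -/

/-- NOT IN PRINT; OUR BOOKKEEPING.  **THE `(d*d)m`-READ OF THE `dψ`-WEIGHTED FIELD ROWS OF `G₀ ∘ W` IS THE `n_m ⊗ dψ` TWO-LEG CHARGE OF THE SOURCE `W`** (in-block root; `W` spread and
bi-localised; `m` bounded `Lc`-periodic; `ψ` bounded): `Σ'_u Σ_κ (d*d m) κ u·(Σ'_x Σ_κ₂ (G₀∘W) u x (inl κ)(inl κ₂)·dzψ κ₂ x) = Σ'_x Σ_κ₂ dzψ κ₂ x·(Σ'_u Σ_κ n_m κ u·W u x (inl κ)(inl κ₂))`,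
`n_m := Π^ρ m − (Lc^{d+1})⁻¹·(𝒬_{Lc}m)(·,0)⊙𝟙^{exit}` — Fubini on the absolutely summable two-leg family and g46 `ExitPairingSourceForm.exitPairing_eq_source'` per `(x, κ₂)`. -/
theorem maxwellRead_comp_eq_sourceRead {Lc : ℕ} [NeZero Lc] {r : Fin (d + 1) → ℕ} (hr : r ∈ box (d + 1) Lc) {W : MKer (d + 1) (Fib d)} (hWs : Spr W) {CW δW : ℝ}
    {p₀ q₀ : Site (d + 1)} (hW : BiLoc W p₀ q₀ CW δW) (hδW : 0 < δW) {m : Form1 (d + 1) ℝ} {B : ℝ} (hmB : ∀ κ u, |m κ u| ≤ B)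
    (hper : ∀ κ x v, m κ (x + (Lc : ℤ) • v) = m κ x) {ψ : Site (d + 1) → ℝ} {Bψ : ℝ} (hψ : ∀ u, |ψ u| ≤ Bψ) :
    ∑' u, ∑ κ, curvAdj (curv m) κ u * (∑' x, ∑ κ₂, comp (coDressKBmAt (toSite r) Lc (KInvStep (d := d) Lc 0)) W u x (Sum.inl κ) (Sum.inl κ₂) * dz ψ κ₂ x)
      = ∑' x, ∑ κ₂, dz ψ κ₂ x * (∑' u, ∑ κ,
          (axProjAt (toSite r) Lc m κ u - ((Lc : ℝ) ^ (d + 1))⁻¹ * (contourSum Lc m κ 0 * (if u κ % (Lc : ℤ) = (Lc : ℤ) - 1 then (1 : ℝ) else 0)))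
            * W u x (Sum.inl κ) (Sum.inl κ₂)) := by
  classical
  have hLc : 1 ≤ Lc := one_le_of_neZero Lc
  set G := coDressKBmAt (toSite r) Lc (KInvStep (d := d) Lc 0) with hGdef
  obtain ⟨δG, CG, hδG, hCG, hG⟩ := decays_coDressKBmAt_KInvStep (d := d) hr 0
  -- `G ∘ W` is bi-localised
  set δ₀ : ℝ := min δG δW with hδ₀def
  have hδ₀ : 0 < δ₀ := lt_min hδG hδW
  have hCW : 0 ≤ CW := hW.nonneg (Sum.inl 0)
  have hG' : Decays G CG δ₀ := decays_mono hG hCG le_rfl (min_le_left _ _)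
  have hW' : BiLoc W p₀ q₀ CW δ₀ := biLoc_mono hW hCW (min_le_right _ _)
  have hA := biLoc_comp_decays hG' hW' (show (0 : ℝ) ≤ δ₀ / 2 by positivity) (by linarith)
  have hδA : 0 < δ₀ / 2 := by positivity
  -- bounds
  have hD : ∀ κ u, |curvAdj (curv m) κ u| ≤ (d + 1 : ℕ) * (2 * (4 * B)) + (d + 1 : ℕ) * (2 * (4 * B)) := fun κ u => abs_curvAdj_curv_le hmB κ u
  have hdz : ∀ κ x, |dz ψ κ x| ≤ 2 * Bψ := fun κ x => abs_dz_le hψ κ x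
  set BD : ℝ := (d + 1 : ℕ) * (2 * (4 * B)) + (d + 1 : ℕ) * (2 * (4 * B)) with hBDdef
  have hω : ∀ (κ κ₂ : Fin (d + 1)) (xz : Site (d + 1) × Site (d + 1)), |curvAdj (curv m) κ xz.1 * dz ψ κ₂ xz.2| ≤ BD * (2 * Bψ) := fun κ κ₂ xz => by
    rw [abs_mul]; exact mul_le_mul (hD κ xz.1) (hdz κ₂ xz.2) (abs_nonneg _) ((abs_nonneg _).trans (hD κ xz.1))
  -- the two-leg family is absolutely summable
  have hsF : Summable fun ux : Site (d + 1) × Site (d + 1) => ∑ κ, ∑ κ₂, (curvAdj (curv m) κ ux.1 * dz ψ κ₂ ux.2) * comp G W ux.1 ux.2 (Sum.inl κ) (Sum.inl κ₂) :=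
    summable_sum fun κ _ => summable_sum fun κ₂ _ => summable_prod_of_biLoc (biLoc_weightMul hA (hω κ κ₂)) hδA (Sum.inl κ) (Sum.inl κ₂)
  have hsU : Summable (Function.uncurry fun u x => ∑ κ, ∑ κ₂, (curvAdj (curv m) κ u * dz ψ κ₂ x) * comp G W u x (Sum.inl κ) (Sum.inl κ₂)) := hsF
  -- left side as an iterated sum of the family
  have eL : ∀ u, (∑ κ, curvAdj (curv m) κ u * (∑' x, ∑ κ₂, comp G W u x (Sum.inl κ) (Sum.inl κ₂) * dz ψ κ₂ x))
      = ∑' x, ∑ κ, ∑ κ₂, (curvAdj (curv m) κ u * dz ψ κ₂ x) * comp G W u x (Sum.inl κ) (Sum.inl κ₂) := by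
    intro u
    have hs : ∀ κ, Summable fun x => ∑ κ₂, comp G W u x (Sum.inl κ) (Sum.inl κ₂) * dz ψ κ₂ x :=
      fun κ => summable_sum fun κ₂ _ => summable_row_mul_of_biLoc hA hδA (hdz κ₂) u (Sum.inl κ) (Sum.inl κ₂)
    calc (∑ κ, curvAdj (curv m) κ u * (∑' x, ∑ κ₂, comp G W u x (Sum.inl κ) (Sum.inl κ₂) * dz ψ κ₂ x))
        = ∑ κ, ∑' x, curvAdj (curv m) κ u * ∑ κ₂, comp G W u x (Sum.inl κ) (Sum.inl κ₂) * dz ψ κ₂ x :=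
          Finset.sum_congr rfl fun κ _ => tsum_mul_left.symm
      _ = ∑' x, ∑ κ, curvAdj (curv m) κ u * ∑ κ₂, comp G W u x (Sum.inl κ) (Sum.inl κ₂) * dz ψ κ₂ x :=
          (Summable.tsum_finsetSum (fun κ _ => (hs κ).mul_left _)).symm
      _ = _ := tsum_congr fun x => Finset.sum_congr rfl fun κ _ => by
          rw [Finset.mul_sum]; exact Finset.sum_congr rfl fun κ₂ _ => by ring
  rw [tsum_congr eL, ← hsU.tsum_comm]
  -- right side, per `x`
  refine tsum_congr fun x => ?_
  have hsu : ∀ κ κ₂, Summable fun u => curvAdj (curv m) κ u * comp G W u x (Sum.inl κ) (Sum.inl κ₂) :=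
    fun κ κ₂ => summable_mul_col_of_biLoc hA hδA (hD κ) x (Sum.inl κ) (Sum.inl κ₂)
  have e1 : ∑' u, ∑ κ, ∑ κ₂, (curvAdj (curv m) κ u * dz ψ κ₂ x) * comp G W u x (Sum.inl κ) (Sum.inl κ₂)
      = ∑ κ₂, dz ψ κ₂ x * ∑' u, ∑ κ, curvAdj (curv m) κ u * comp G W u x (Sum.inl κ) (Sum.inl κ₂) := by
    have e : ∀ u, (∑ κ, ∑ κ₂, (curvAdj (curv m) κ u * dz ψ κ₂ x) * comp G W u x (Sum.inl κ) (Sum.inl κ₂))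
        = ∑ κ₂, dz ψ κ₂ x * ∑ κ, curvAdj (curv m) κ u * comp G W u x (Sum.inl κ) (Sum.inl κ₂) := by
      intro u
      rw [Finset.sum_comm]
      refine Finset.sum_congr rfl fun κ₂ _ => ?_
      rw [Finset.mul_sum]
      exact Finset.sum_congr rfl fun κ _ => by ring
    rw [tsum_congr e, Summable.tsum_finsetSum (fun κ₂ _ => (summable_sum fun κ _ => hsu κ κ₂).mul_left _)]
    exact Finset.sum_congr rfl fun κ₂ _ => tsum_mul_left
  rw [e1]
  refine Finset.sum_congr rfl fun κ₂ _ => ?_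
  congr 1
  rw [hGdef, exitPairing_eq_source' hr hWs hW hδW hmB hper x (Sum.inl κ₂)]
  -- expand `n_m` on the right
  have hPi : ∀ κ u, |axProjAt (toSite r) Lc m κ u| ≤ B + 2 * ((((d + 1 : ℕ) : ℝ)) * Lc * B) := fun κ u => abs_axProjAt_le hLc hr hmB κ u
  have hsPi : ∀ κ, Summable fun u => axProjAt (toSite r) Lc m κ u * W u x (Sum.inl κ) (Sum.inl κ₂) :=
    fun κ => summable_mul_col_of_biLoc hW hδW (hPi κ) x (Sum.inl κ) (Sum.inl κ₂)
  have hsE : ∀ κ, Summable fun u => (if u κ % (Lc : ℤ) = (Lc : ℤ) - 1 then (1 : ℝ) else 0) * W u x (Sum.inl κ) (Sum.inl κ₂) :=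
    fun κ => summable_mul_col_of_biLoc hW hδW (B := 1) (fun u => by split_ifs <;> simp) x (Sum.inl κ) (Sum.inl κ₂)
  have e2 : ∀ u, (∑ κ, (axProjAt (toSite r) Lc m κ u - ((Lc : ℝ) ^ (d + 1))⁻¹ * (contourSum Lc m κ 0 * (if u κ % (Lc : ℤ) = (Lc : ℤ) - 1 then (1 : ℝ) else 0)))
        * W u x (Sum.inl κ) (Sum.inl κ₂))
      = (∑ κ, axProjAt (toSite r) Lc m κ u * W u x (Sum.inl κ) (Sum.inl κ₂))
        - ∑ κ, ((Lc : ℝ) ^ (d + 1))⁻¹ * contourSum Lc m κ 0 * ((if u κ % (Lc : ℤ) = (Lc : ℤ) - 1 then (1 : ℝ) else 0) * W u x (Sum.inl κ) (Sum.inl κ₂)) := by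
    intro u
    rw [← Finset.sum_sub_distrib]
    exact Finset.sum_congr rfl fun κ _ => by ring
  rw [tsum_congr e2, (summable_sum fun κ _ => hsPi κ).tsum_sub (summable_sum fun κ _ => ((hsE κ).mul_left _)),
    Summable.tsum_finsetSum (fun κ _ => (hsE κ).mul_left _)]
  congr 1
  rw [Finset.mul_sum]
  exact Finset.sum_congr rfl fun κ _ => by rw [tsum_mul_left, mul_assoc]

/-! ## §4 The (γ) exit pairing at level 0 in closed form -/

/-- NOT IN PRINT; OUR BOOKKEEPING.  **THE (γ)-TYPE EXIT PAIRING AT jb = 0, CLOSED FORM WITH ONE DISPLAYED DEFECT.**  In-block root `ρ = toSite r`; `G₀ = coDressKBmAt ρ Lc (KInvStep Lc 0)`,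
`S₀ = SpureRecAt … 0`, `M₀ = M1At … 0`, slot `e = (ν, y′)`, the literal (γ) response source `𝒟(e) = dM G₀ Lc S₀ M₀ ν y′` (leaf-06 g45 `GaugeReadChargeComb`); `m` a bounded `Lc`-periodic
1-form, `ψ` a bounded gauge function.  THE MAXWELL-IMAGE READ OF THE `dψ`-WEIGHTED (γ) RESPONSE ROWS IS
`Σ'_u Σ_κ (d*d m) κ u·(Σ'_x Σ_κ₂ (G₀∘𝒟(e)) u x (inl κ)(inl κ₂)·dzψ κ₂ x)`
`= −(cE∕2)·Σ'_t Σ_l ψ(t + e_l)·colH G₀ Lc ν y′ l t·(d*d m)_l(t) + (cE∕4 − cΛ·wM1 0·(2Lc^{d+1})⁻¹)·Σ'_w Σ_κ 𝒬_{Lc}(σ_ψ ⊙ n_m) κ w·colM G₀ Lc ν y′ κ w`,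
`σ_ψ(κ,u) = ψ u + ψ(u+e_κ)`, `n_m = Π^ρ m − (Lc^{d+1})⁻¹·(𝒬_{Lc} m)(·,0)⊙𝟙^{exit}`.  With `ψ = 1_{B(y)}` (`dzψ = gaugeWt Lc y`) and `m` the edge potential `m̃_ab` the left side is
the `(d*d)m̃_ab`-read of the (γ) read weights of `GaugeReadChargeComb` ∕ `GaugeReadChargeProfile` — by leaf-02 g56's `SrecExitChargeLevelZero` the exit⊗exit (γ) charge of the slot up
to `−cE∕4·(norm)` — and the first right-hand term is ENGINE E-leaf06-g46-1's `R(e)` (`g⁺ = ½·1_{B(y)}(·+e)`); (M1) ⟺ the defect's contour sums vanish (ENGINE (M3): they do). -/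
theorem gaugeRead_exitPairing {Lc : ℕ} [NeZero Lc] {r : Fin (d + 1) → ℕ} (hr : r ∈ box (d + 1) Lc) (cE cVH cΛ : ℝ) (ν : Fin (d + 1)) (y' : Site (d + 1))
    {m : Form1 (d + 1) ℝ} {B : ℝ} (hmB : ∀ κ u, |m κ u| ≤ B) (hper : ∀ κ x v, m κ (x + (Lc : ℤ) • v) = m κ x)
    {ψ : Site (d + 1) → ℝ} {Bψ : ℝ} (hψ : ∀ u, |ψ u| ≤ Bψ) :
    ∑' u, ∑ κ, curvAdj (curv m) κ u * (∑' x, ∑ κ₂,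
        comp (coDressKBmAt (toSite r) Lc (KInvStep (d := d) Lc 0))
          (dM (coDressKBmAt (toSite r) Lc (KInvStep (d := d) Lc 0)) Lc (SpureRecAt d Lc (toSite r) cE cVH cΛ 0) (M1At d Lc (toSite r) cΛ 0) ν y')
          u x (Sum.inl κ) (Sum.inl κ₂) * dz ψ κ₂ x)
      = -(cE / 2) * (∑' t, ∑ l, ψ (t + unitVec l) * colH (coDressKBmAt (toSite r) Lc (KInvStep (d := d) Lc 0)) Lc ν y' l t * curvAdj (curv m) l t)
        + (cE / 4 - (cΛ * wM1 d Lc 0) * (2 * (Lc : ℝ) ^ (d + 1))⁻¹)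
          * ∑' w, ∑ κ, contourSum Lc (fun κ u => (ψ u + ψ (u + unitVec κ))
              * (axProjAt (toSite r) Lc m κ u - ((Lc : ℝ) ^ (d + 1))⁻¹ * (contourSum Lc m κ 0 * (if u κ % (Lc : ℤ) = (Lc : ℤ) - 1 then (1 : ℝ) else 0)))) κ w
            * colM (coDressKBmAt (toSite r) Lc (KInvStep (d := d) Lc 0)) Lc ν y' κ w := by
  classical
  have hLc : 1 ≤ Lc := one_le_of_neZero Lc
  -- the source `𝒟(e)` is bi-localised and spread
  obtain ⟨δG, CG, hδG, hCG, hG⟩ := decays_coDressKBmAt_KInvStep (d := d) hr 0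
  obtain ⟨Cs, δs, hδs, hS⟩ := locStencil_SpureRecAt (d := d) (Lc := Lc) hLc hr cE cVH cΛ 0
  have hCs : 0 ≤ Cs := (hS 0 0).nonneg (Sum.inl 0)
  have hδ : 0 < min δs δG := lt_min hδs hδG
  have hSδ : LocStencil (SpureRecAt d Lc (toSite r) cE cVH cΛ 0) Cs (min δs δG) := locStencil_mono hS hCs (min_le_left _ _)
  have hMδ := vertexFamily_M1At (d := d) (Lc := Lc) hLc hr cΛ 0 hδ.le
  have hW := vertexFamily_dM (N := Lc) hG hCG hSδ hMδ hδ (min_le_right _ _) ν y'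
  have hδ2 : 0 < min δs δG / 2 := by positivity
  have hWs : Spr (dM (coDressKBmAt (toSite r) Lc (KInvStep (d := d) Lc 0)) Lc (SpureRecAt d Lc (toSite r) cE cVH cΛ 0) (M1At d Lc (toSite r) cΛ 0) ν y') :=
    ⟨_, _, hδ2, decays_of_biLoc hW hδ2.le⟩
  have h1 := maxwellRead_comp_eq_sourceRead hr hWs hW hδ2 hmB hper hψ
  have hnB := fun κ u => abs_sourceForm_le hLc hr hmB (((Lc : ℝ) ^ (d + 1))⁻¹) (fun κ' => contourSum Lc m κ' 0) κ u
  have hn0 : ∀ κ u, IsCombBondAt (toSite r) Lc κ u →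
      (fun κ' u => axProjAt (toSite r) Lc m κ' u - ((Lc : ℝ) ^ (d + 1))⁻¹ * (contourSum Lc m κ' 0 * (if u κ' % (Lc : ℤ) = (Lc : ℤ) - 1 then (1 : ℝ) else 0))) κ u = 0 :=
    fun κ u h => sourceForm_eq_zero_of_isCombBond hLc (toSite r) m (((Lc : ℝ) ^ (d + 1))⁻¹) (fun κ' => contourSum Lc m κ' 0) h
  have h2 := gaugeLeg_sourcePairing_dM hr cE cVH cΛ ν y' hnB hn0 (fun κ w => contourSum_sourceForm_eq_zero r hper κ w) hψ
  have h3 := curvAdj_curv_sourceForm hLc (toSite r) m (((Lc : ℝ) ^ (d + 1))⁻¹) (fun κ' => contourSum Lc m κ' 0)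
  rw [h1, h2, h3]

/-- NOT IN PRINT; OUR BOOKKEEPING.  **THE (γ) EXIT PAIRING OF THE LABEL `y`** (`ψ = 1_{B(y)}`, the weight `gaugeWt Lc y` of `GaugeReadChargeComb`): the `(d*d)m`-read of the (γ) read weights
`w_κ(u) = Σ'_x Σ_κ₂ (G₀∘𝒟(e)) u x (inl κ)(inl κ₂)·gaugeWt Lc y κ₂ x` is `−(cE∕2)·Σ'_t Σ_l 1_{B(y)}(t+e_l)·colH G₀(e) l t·(d*d m)_l(t)` plus the displayed defect. -/
theorem gaugeRead_exitPairing_gaugeWt {Lc : ℕ} [NeZero Lc] {r : Fin (d + 1) → ℕ} (hr : r ∈ box (d + 1) Lc) (cE cVH cΛ : ℝ) (ν : Fin (d + 1)) (y' y : Site (d + 1))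
    {m : Form1 (d + 1) ℝ} {B : ℝ} (hmB : ∀ κ u, |m κ u| ≤ B) (hper : ∀ κ x v, m κ (x + (Lc : ℤ) • v) = m κ x) :
    ∑' u, ∑ κ, curvAdj (curv m) κ u * (∑' x, ∑ κ₂,
        comp (coDressKBmAt (toSite r) Lc (KInvStep (d := d) Lc 0))
          (dM (coDressKBmAt (toSite r) Lc (KInvStep (d := d) Lc 0)) Lc (SpureRecAt d Lc (toSite r) cE cVH cΛ 0) (M1At d Lc (toSite r) cΛ 0) ν y')
          u x (Sum.inl κ) (Sum.inl κ₂) * gaugeWt Lc y κ₂ x)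
      = -(cE / 2) * (∑' t, ∑ l, (if blk Lc (t + unitVec l) = y then (1 : ℝ) else 0)
            * colH (coDressKBmAt (toSite r) Lc (KInvStep (d := d) Lc 0)) Lc ν y' l t * curvAdj (curv m) l t)
        + (cE / 4 - (cΛ * wM1 d Lc 0) * (2 * (Lc : ℝ) ^ (d + 1))⁻¹)
          * ∑' w, ∑ κ, contourSum Lc (fun κ u => ((if blk Lc u = y then (1 : ℝ) else 0) + (if blk Lc (u + unitVec κ) = y then (1 : ℝ) else 0))
              * (axProjAt (toSite r) Lc m κ u - ((Lc : ℝ) ^ (d + 1))⁻¹ * (contourSum Lc m κ 0 * (if u κ % (Lc : ℤ) = (Lc : ℤ) - 1 then (1 : ℝ) else 0)))) κ w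
            * colM (coDressKBmAt (toSite r) Lc (KInvStep (d := d) Lc 0)) Lc ν y' κ w := by
  simp only [gaugeWt_eq_dz]
  exact gaugeRead_exitPairing hr cE cVH cΛ ν y' hmB hper (ψ := fun w : Site (d + 1) => if blk Lc w = y then (1 : ℝ) else 0) (Bψ := 1)
    (fun u => by split_ifs <;> simp)

end Summit.QuantumFields.BalabanUV.Beta.GAN24.GaugeReadExitPairing

end
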